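import Summits.Ventures.HodgeRepro2.T5SU11LegendreIdentities

/-!
# Orthogonality of the Legendre polynomials: `∫_{−1}^{1} P_m P_n = 2δ_{mn}/(2n + 1)`

From Legendre's equation in Sturm–Liouville form `((1 − x²) P_n')' = −n(n + 1) P_n`
(`T5SU11SphericalLegendreAll.legendre_ode`) and one integration by parts on `[−1, 1]` (the boundary terms vanish
because `1 − x² = 0` at `±1`):

  **`n(n + 1) ∫_{−1}^{1} P_m P_n = ∫_{−1}^{1} (1 − x²) P_m' P_n'`**   (`integral_legP_mul_legP_eq`),

which is symmetric in `(m, n)`, so **`∫_{−1}^{1} P_m P_n = 0` for `m ≠ n`** (`integral_legP_mul_legP_of_ne`). The norms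
follow from Bonnet's recursion and orthogonality, `I_{n+2} = ((2n + 3)/(2n + 5)) I_{n+1}` (`integral_legP_sq_succ_succ`),
hence **`∫_{−1}^{1} P_n² = 2/(2n + 1)`** (`integral_legP_sq`) and the full orthogonality relation
**`∫_{−1}^{1} P_m P_n = if m = n then 2/(2n + 1) else 0`** (`integral_legP_mul_legP`). Also the Dirichlet-type
energy identity **`∫_{−1}^{1} (1 − x²) P_n'² = 2n(n + 1)/(2n + 1)`** (`integral_one_sub_sq_mul_legQ_sq`).

The Legendre polynomials of the lane are the spherical functions of even integer parameter on `[1, ∞)`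
(`φ_{2n+2}(a_t) = P_n(cosh 2t)`); on `[−1, 1]` they are the zonal spherical functions of the compact dual, and this
file records their `L²[−1, 1]` orthogonality for completeness of the Legendre chapter. Nothing is claimed about (N).

Blind lane: Mathlib + the HodgeRepro2 prefix only; no sorry; axioms ⊆ {propext, Classical.choice,
Quot.sound}.
-/

namespace Summit.Ventures.HodgeRepro2.T5SU11LegendreOrthogonal

open MeasureTheory Metric Set Filter Topology Finset intervalIntegral
open T5SU11SphericalLegendreAll T5SU11SphericalLegendreLaplace T5SU11LegendreIdentities

/-! ### Continuity and integrability -/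

/-- `P'_n` is continuous. -/
theorem continuous_legQ (n : ℕ) : Continuous (legQ n) :=
  continuous_iff_continuousAt.mpr fun x => (hasDerivAt_legQ n x).continuousAt

/-- `(1 − x²) P'_n` is an antiderivative of `−n(n + 1) P_n` (Legendre's equation in Sturm–Liouville form). -/
theorem hasDerivAt_one_sub_sq_mul_legQ (n : ℕ) (x : ℝ) :
    HasDerivAt (fun x => (1 - x ^ 2) * legQ n x) (-((n : ℝ) * (n + 1)) * legP n x) x := by
  have h := ((hasDerivAt_const x (1 : ℝ)).sub (hasDerivAt_pow 2 x)).mul (hasDerivAt_legQ n x)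
  refine (h.congr_deriv ?_).congr_of_eventuallyEq (Filter.Eventually.of_forall fun y => ?_)
  · simp only [Pi.sub_apply]
    have := legendre_ode n x
    norm_num
    linear_combination -this
  · simp only [Pi.mul_apply, Pi.sub_apply]

/-! ### The integration by parts -/

/-- **`n(n + 1) ∫_{−1}^{1} P_m P_n = ∫_{−1}^{1} (1 − x²) P'_m P'_n`.** -/
theorem integral_legP_mul_legP_eq (m n : ℕ) :
    (n : ℝ) * (n + 1) * ∫ x in (-1 : ℝ)..1, legP m x * legP n x
      = ∫ x in (-1 : ℝ)..1, (1 - x ^ 2) * legQ m x * legQ n x := by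
  have hu : ∀ x ∈ uIcc (-1 : ℝ) 1, HasDerivAt (legP m) (legQ m x) x := fun x _ => hasDerivAt_legP m x
  have hv : ∀ x ∈ uIcc (-1 : ℝ) 1,
      HasDerivAt (fun x => (1 - x ^ 2) * legQ n x) (-((n : ℝ) * (n + 1)) * legP n x) x :=
    fun x _ => hasDerivAt_one_sub_sq_mul_legQ n x
  have hu' : IntervalIntegrable (legQ m) volume (-1 : ℝ) 1 := (continuous_legQ m).intervalIntegrable _ _
  have hv' : IntervalIntegrable (fun x => -((n : ℝ) * (n + 1)) * legP n x) volume (-1 : ℝ) 1 :=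
    ((continuous_legP n).const_mul _).intervalIntegrable _ _
  have h := integral_mul_deriv_eq_deriv_mul hu hv hu' hv'
  simp only [one_pow, sub_self, zero_mul, mul_zero, zero_sub] at h
  have e1 : ∫ x in (-1 : ℝ)..1, legP m x * (-((n : ℝ) * (n + 1)) * legP n x)
      = -((n : ℝ) * (n + 1)) * ∫ x in (-1 : ℝ)..1, legP m x * legP n x := by
    rw [← intervalIntegral.integral_const_mul]
    refine integral_congr fun x _ => ?_
    ring
  have e2 : ∫ x in (-1 : ℝ)..1, legQ m x * ((1 - x ^ 2) * legQ n x)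
      = ∫ x in (-1 : ℝ)..1, (1 - x ^ 2) * legQ m x * legQ n x := by
    refine integral_congr fun x _ => ?_
    ring
  rw [e1, e2] at h
  linear_combination -h

/-- The symmetric form of the energy integral. -/
theorem integral_energy_symm (m n : ℕ) :
    ∫ x in (-1 : ℝ)..1, (1 - x ^ 2) * legQ m x * legQ n x
      = ∫ x in (-1 : ℝ)..1, (1 - x ^ 2) * legQ n x * legQ m x := by
  refine integral_congr fun x _ => ?_
  ring

/-- **Orthogonality: `∫_{−1}^{1} P_m P_n = 0` for `m ≠ n`.** -/
theorem integral_legP_mul_legP_of_ne {m n : ℕ} (h : m ≠ n) :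
    ∫ x in (-1 : ℝ)..1, legP m x * legP n x = 0 := by
  have h1 := integral_legP_mul_legP_eq m n
  have h2 := integral_legP_mul_legP_eq n m
  have hsym : ∫ x in (-1 : ℝ)..1, legP n x * legP m x = ∫ x in (-1 : ℝ)..1, legP m x * legP n x := by
    refine integral_congr fun x _ => ?_
    ring
  rw [hsym, integral_energy_symm] at h2
  have hne : ((n : ℝ) - m) * ((n : ℝ) + m + 1) ≠ 0 := by
    refine mul_ne_zero ?_ ?_
    · intro h0
      apply h
      exact_mod_cast (sub_eq_zero.mp h0).symm
    · have : (0 : ℝ) ≤ n := Nat.cast_nonneg n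
      have : (0 : ℝ) ≤ m := Nat.cast_nonneg m
      positivity
  have key : ((n : ℝ) - m) * ((n : ℝ) + m + 1) * ∫ x in (-1 : ℝ)..1, legP m x * legP n x = 0 := by
    linear_combination h1 - h2
  rcases mul_eq_zero.mp key with h0 | h0
  · exact absurd h0 hne
  · exact h0

/-! ### The norms -/

/-- Bonnet's recursion integrated against a continuous `f`:
`(n + 2) ∫ P_{n+2} f = (2n + 3) ∫ x P_{n+1} f − (n + 1) ∫ P_n f`. -/
theorem integral_bonnet_mul (n : ℕ) {f : ℝ → ℝ} (hf : Continuous f) :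
    ((n : ℝ) + 2) * ∫ x in (-1 : ℝ)..1, legP (n + 2) x * f x
      = (2 * (n : ℝ) + 3) * (∫ x in (-1 : ℝ)..1, x * legP (n + 1) x * f x)
        - ((n : ℝ) + 1) * ∫ x in (-1 : ℝ)..1, legP n x * f x := by
  have hn : ((n : ℝ) + 2) ≠ 0 := by positivity
  have hi1 : IntervalIntegrable (fun x => (2 * (n : ℝ) + 3) * (x * legP (n + 1) x * f x)) volume (-1 : ℝ) 1 :=
    (((continuous_id.mul (continuous_legP (n + 1))).mul hf).const_mul _).intervalIntegrable _ _
  have hi2 : IntervalIntegrable (fun x => ((n : ℝ) + 1) * (legP n x * f x)) volume (-1 : ℝ) 1 :=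
    (((continuous_legP n).mul hf).const_mul _).intervalIntegrable _ _
  rw [← intervalIntegral.integral_const_mul, ← intervalIntegral.integral_const_mul,
    ← intervalIntegral.integral_const_mul, ← intervalIntegral.integral_sub hi1 hi2]
  refine integral_congr fun x _ => ?_
  rw [legP_succ_succ]
  field_simp

/-- **`I_{n+2} = ((2n + 3)/(2n + 5)) I_{n+1}`** for `I_n := ∫_{−1}^{1} P_n²`. -/
theorem integral_legP_sq_succ_succ (n : ℕ) :
    ∫ x in (-1 : ℝ)..1, legP (n + 2) x ^ 2
      = (2 * (n : ℝ) + 3) / (2 * (n : ℝ) + 5) * ∫ x in (-1 : ℝ)..1, legP (n + 1) x ^ 2 := by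
  -- (i) Bonnet at `n` against `P_{n+2}`
  have h1 := integral_bonnet_mul n (continuous_legP (n + 2))
  simp only [integral_legP_mul_legP_of_ne (show n ≠ n + 2 by omega), mul_zero, sub_zero] at h1
  -- (ii) Bonnet at `n + 1` against `P_{n+1}`
  have h2 := integral_bonnet_mul (n + 1) (continuous_legP (n + 1))
  rw [show n + 1 + 2 = n + 3 from rfl, show n + 1 + 1 = n + 2 from rfl] at h2
  simp only [integral_legP_mul_legP_of_ne (show n + 3 ≠ n + 1 by omega), mul_zero] at h2
  push_cast at h2
  have hJ : ∫ x in (-1 : ℝ)..1, x * legP (n + 2) x * legP (n + 1) x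
      = ∫ x in (-1 : ℝ)..1, x * legP (n + 1) x * legP (n + 2) x := by
    refine integral_congr fun x _ => ?_
    ring
  rw [hJ] at h2
  have hsq : ∀ k : ℕ, ∫ x in (-1 : ℝ)..1, legP k x * legP k x = ∫ x in (-1 : ℝ)..1, legP k x ^ 2 := fun k => by
    refine integral_congr fun x _ => ?_
    ring
  rw [hsq] at h1 h2
  have h5 : (2 * (n : ℝ) + 5) ≠ 0 := by positivity
  have h2' : (n : ℝ) + 2 ≠ 0 := by positivity
  rw [div_mul_eq_mul_div, eq_div_iff h5]
  have : ((n : ℝ) + 2) * ((∫ x in (-1 : ℝ)..1, legP (n + 2) x ^ 2) * (2 * (n : ℝ) + 5))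
      = ((n : ℝ) + 2) * ((2 * (n : ℝ) + 3) * ∫ x in (-1 : ℝ)..1, legP (n + 1) x ^ 2) := by
    linear_combination (2 * (n : ℝ) + 5) * h1 - (2 * (n : ℝ) + 3) * h2
  exact mul_left_cancel₀ h2' this

/-- `I_0 = 2`. -/
theorem integral_legP_zero_sq : ∫ x in (-1 : ℝ)..1, legP 0 x ^ 2 = 2 := by
  simp only [legP_zero, one_pow]
  rw [intervalIntegral.integral_const]
  norm_num

/-- `I_1 = 2/3`. -/
theorem integral_legP_one_sq : ∫ x in (-1 : ℝ)..1, legP 1 x ^ 2 = 2 / 3 := by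
  simp only [legP_one']
  rw [integral_pow]
  norm_num

/-- **`∫_{−1}^{1} P_n² = 2/(2n + 1)`.** -/
theorem integral_legP_sq (n : ℕ) : ∫ x in (-1 : ℝ)..1, legP n x ^ 2 = 2 / (2 * (n : ℝ) + 1) := by
  induction n using Nat.twoStepInduction with
  | zero => rw [integral_legP_zero_sq]; norm_num
  | one => rw [integral_legP_one_sq]; norm_num
  | more n _ ih =>
    rw [integral_legP_sq_succ_succ, ih]
    push_cast
    have h3 : (2 * (n : ℝ) + 3) ≠ 0 := by positivity
    have h5 : (2 * (n : ℝ) + 5) ≠ 0 := by positivity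
    field_simp
    ring

/-- **The orthogonality relation `∫_{−1}^{1} P_m P_n = 2δ_{mn}/(2n + 1)`.** -/
theorem integral_legP_mul_legP (m n : ℕ) :
    ∫ x in (-1 : ℝ)..1, legP m x * legP n x = if m = n then 2 / (2 * (n : ℝ) + 1) else 0 := by
  split_ifs with h
  · subst h
    rw [← integral_legP_sq]
    refine integral_congr fun x _ => ?_
    ring
  · exact integral_legP_mul_legP_of_ne h

/-- **The energy identity `∫_{−1}^{1} (1 − x²) P'_n² = 2n(n + 1)/(2n + 1)`.** -/
theorem integral_one_sub_sq_mul_legQ_sq (n : ℕ) :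
    ∫ x in (-1 : ℝ)..1, (1 - x ^ 2) * legQ n x ^ 2 = 2 * (n : ℝ) * (n + 1) / (2 * (n : ℝ) + 1) := by
  have h := integral_legP_mul_legP_eq n n
  have e1 : ∫ x in (-1 : ℝ)..1, (1 - x ^ 2) * legQ n x * legQ n x
      = ∫ x in (-1 : ℝ)..1, (1 - x ^ 2) * legQ n x ^ 2 := by
    refine integral_congr fun x _ => ?_
    ring
  have e2 : ∫ x in (-1 : ℝ)..1, legP n x * legP n x = ∫ x in (-1 : ℝ)..1, legP n x ^ 2 := by
    refine integral_congr fun x _ => ?_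
    ring
  rw [e1, e2, integral_legP_sq] at h
  rw [← h]
  have h1 : (2 * (n : ℝ) + 1) ≠ 0 := by positivity
  field_simp

end Summit.Ventures.HodgeRepro2.T5SU11LegendreOrthogonal
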